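import Summits.FinalStateConjecture.FinalStateConjecture.Theses.ExactKerrEnds
import Summits.FinalStateConjecture.FinalStateConjecture.Theorems.ExactKerrEndsCensorshipAlongKerrEndsDefs
import Summits.FinalStateConjecture.FinalStateConjecture.Theorems.ExactKerrEndsCensorshipAlongKerrEndsWindowUpgrade
import Summits.FinalStateConjecture.FinalStateConjecture.Theorems.ExactKerrEndsCensorshipAlongKerrEndsRecedingSelection
import Summits.FinalStateConjecture.FinalStateConjecture.Theorems.ExactKerrEndsTameEscapeToKerrEndsChartKerrEnd
import Summits.FinalStateConjecture.FinalStateConjecture.Theorems.ExactKerrEndsTameEscapeToKerrEndsMinkowskiLeaf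
import Summits.FinalStateConjecture.FinalStateConjecture.Theorems.SwallowTheDatumTargetGlue
import Literature.Geometry.Lorentzian.TameBreathingCurve
import HarnessLib

/-!
# Route `ExactKerrEnds`, crux `CensorshipAlongKerrEnds` (stmt-FinalStateConjecture-18521), line `Sketch`:
# the CORE stub dominates the sibling crux `TameEscapeToKerrEnds` (stmt-FinalStateConjecture-18522)

Record (registered sub-goal `tameEscapeToKerrEnds_of_gluingAlongFamily_of_items` of the crux item): the open analytic
core of line `Sketch` — matched exterior Kerr gluing ALONG a tame family, `stub_gluingAlongFamily`, stated over the
route-posited predicates of `…CensorshipAlongKerrEndsDefs.lean` — together with the route's two positive-mass ITEMS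
`AdmissibleMassNonneg` (stmt-18051) and `ZeroMassAdmissibleMinkowskian` (stmt-18053) already implies the sibling crux
`TameEscapeToKerrEnds` (Kerr-endedness is tame-generic); stated with the route's glue item BY NAME, the core alone
implies `TameEscapeGivenMassTheorems` (stmt-18158, route-repair rev 5: `AdmissibleMassNonneg →
ZeroMassAdmissibleMinkowskian → TameEscapeToKerrEnds`).  So the core is at least crux-E-hard; no physics enters.

Proof: at an admissible datum `d` which is not Kerr-ended, read off its sole DR end `(e, M)` from its tame
self-witness (`InitialDataSet.exists_tame_selfWitness`, the breathing curve `G` through `d`); `M ≤ 0` is impossible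
(the items make such a datum Minkowskian, hence Kerr-ended:
`hasExactKerrEnd_of_cauchyDevelopment_eq_minkowski`); for `M > 0` glue along `G` (the core), serve the bands by
chart-exactness alone (`chartKerrEnd`, threshold `R⋆`), select a receding radius
(landed `stub_recedingSelection`) and upgrade the window (landed `stub_windowUpgrade`).  No definitions, no named
facts.  Christodoulou, CQG 16 (1999) A23, p. A24; Corvino–Schoen, JDG 73 (2006), Thm. 4.
-/

-- the summit-side namespace `Summit.FinalStateConjecture.FinalStateConjecture.…` (summit = problem)
-- doubles the `FinalStateConjecture` path component by design; `dupNamespace` would flag every decl.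
set_option linter.dupNamespace false

noncomputable section

open scoped Manifold ContDiff Topology ENNReal
open Set Function Filter TopologicalSpace Literature.Geometry.Lorentzian
open Summit.FinalStateConjecture.FinalStateConjecture.Theses.ExactKerrEnds
  (TameEscapeToKerrEnds AdmissibleMassNonneg ZeroMassAdmissibleMinkowskian TameEscapeGivenMassTheorems)

namespace Summit.FinalStateConjecture.FinalStateConjecture.Theorems.ExactKerrEnds.CensorshipAlongKerrEnds

/-- **Registered sub-goal `tameEscapeToKerrEnds_of_gluingAlongFamily_of_items` of the crux item
(stmt-FinalStateConjecture-18521): the core stub of line `Sketch` implies the route's glue item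
`TameEscapeGivenMassTheorems` (stmt-18158) — with the two positive-mass items, the sibling crux `TameEscapeToKerrEnds`.**
[cite: Christodoulou1999, p. A24] [cite: CorvinoSchoen2006, Thm. 4] -/
theorem tameEscapeToKerrEnds_of_gluingAlongFamily_of_items : (∀ (X : Type) [TopologicalSpace X] [ChartedSpace E3 X] [IsManifold (𝓡 3) ((⊤ : ℕ∞) : WithTop ℕ∞) X] [T2Space X] [SecondCountableTopology X] [ConnectedSpace X], ∀ [Kerr.Facts], ∀ (e : AFEnd X) (G : EuclideanSpace ℝ (Fin 1) → InitialDataSet (𝓡 3) X) (Mf : EuclideanSpace ℝ (Fin 1) → ℝ), InitialDataSet.IsTameDataFamily e 1 G → (∀ c, G c ∈ admissibleVacuumData X) → Continuous Mf → (∀ c, e.IsStronglyAsymptoticallyFlatDR (G c) (Mf c)) → 0 < Mf 0 → ∃ (ε Rstar : ℝ) (m : EuclideanSpace ℝ (Fin 1) → ℝ → ℝ) (H : EuclideanSpace ℝ (Fin 1) → ℝ → InitialDataSet (𝓡 3) X), 0 < ε ∧ e.R < Rstar ∧ GluedStructure e G ε Rstar m H ∧ (∀ (c : EuclideanSpace ℝ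 (Fin 1)) (R : ℝ), ‖c‖ < ε → Rstar < R → H c R ∈ admissibleVacuumData X ∧ IsChartExactKerrBeyond e (H c R) (4 * R)) ∧ (∀ c : EuclideanSpace ℝ (Fin 1), ‖c‖ < ε → Filter.Tendsto (fun R ↦ e.wDist (H c R) (G c)) Filter.atTop (nhds 0)) ∧ JointConvergence e G Mf ε Rstar m H ∧ UniformBound e G ε Rstar H) → TameEscapeGivenMassTheorems := by
  intro hcore hA hZ X _ _ _ _ _ _ KerrEnded' d hd
  obtain ⟨hd𝓓, hdexc⟩ := hd
  obtain ⟨e, G, hGt, hGi, hG0, -, hGadm, -⟩ := InitialDataSet.exists_tame_selfWitness hd𝓓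
  obtain ⟨Mf, hMf, hDR⟩ := hGt.2.2.1
  have hsole : e.IsSoleEnd := hGt.2.1
  by_cases hpos : 0 < Mf 0
  · haveI : Kerr.Facts := SwallowTheDatum.kerrFacts
    obtain ⟨ε₀, Rstar, m, H, hε₀, hRstar, hstr, hmem, -, hjoint, -⟩ := hcore X e G Mf hGt hGadm hMf hDR hpos
    -- the bands are served by the core alone: admissible ∧ Kerr-ended beyond the threshold `R⋆`
    have hP : EventuallyOnBands (fun D ↦ D ∈ admissibleVacuumData X ∧ D.HasExactKerrEnd) ε₀ Rstar H := by
      intro C _ _ hCε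
      refine ⟨Rstar, le_rfl, fun c hc R hR ↦ ?_⟩
      have hcε : ‖c‖ < ε₀ := by simpa using hCε hc
      obtain ⟨hadm', hchart⟩ := hmem c R hcε hR
      have hpos' : 0 < R := lt_trans e.R_pos (lt_trans hRstar hR)
      exact ⟨hadm', chartKerrEnd X e (H c R) (4 * R) hsole (by linarith) hchart⟩
    obtain ⟨F', hF't, hF'i, hF'0, ε', hε', hF'P⟩ :=
      stub_recedingSelection X (fun D ↦ D ∈ admissibleVacuumData X ∧ D.HasExactKerrEnd) e G Mf ε₀ Rstar m H
        hGt hGi hMf hDR hε₀ hRstar hstr hjoint hP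
    obtain ⟨F'', hF''t, hF''0, hF''inj, hF''i, hP''⟩ :=
      stub_windowUpgrade X (fun D ↦ D ∈ admissibleVacuumData X ∧ D.HasExactKerrEnd) e F' hF't hF'i ⟨ε', hε', hF'P⟩
    refine ⟨e, F'', hF''t, hF''i, hF''0.trans (hF'0.trans hG0), hF''inj, fun c ↦ ?_,
      fun c hc hbad ↦ hbad.2 (hP'' c hc).2⟩
    by_cases hc : c = 0
    · subst hc
      rw [hF''0, hF'0, hG0]
      exact hd𝓓
    · exact (hP'' c hc).1
  · -- non-positive mass: the datum is Minkowskian, hence Kerr-ended — contradiction with exceptionality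
    have hM0 : Mf 0 = 0 := le_antisymm (not_lt.mp hpos) (hA X (G 0) (hGadm 0) e (Mf 0) hsole (hDR 0))
    have hDR0 : e.IsStronglyAsymptoticallyFlatDR (G 0) 0 := hM0 ▸ hDR 0
    obtain ⟨𝒟, h𝒟⟩ := hZ X (G 0) (hGadm 0) e hsole hDR0
    have hKE : d.HasExactKerrEnd := by
      rw [← hG0]
      exact hasExactKerrEnd_of_cauchyDevelopment_eq_minkowski X (G 0) e hsole 𝒟 h𝒟
    exact (hdexc hKE).elim

end Summit.FinalStateConjecture.FinalStateConjecture.Theorems.ExactKerrEnds.CensorshipAlongKerrEnds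

end
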